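import Literature.Geometry.Lorentzian.StationaryOrbitTimeFunction
import HarnessLib

/-!
# The trivialisation `M ≅ ℝ × S` of a chronological stationary space-time
(Anderson 2000, §0, (0.1): `M = ℝ × S`, `X = ∂_t`; the principal `ℝ`-bundle `π : M → S` is trivial)

With a global time function `t : M → ℝ`, `t(θ(s, y)) = t(y) + s`
(`IsStationaryKilling.exists_timeFunction`, `StationaryOrbitTimeFunction.lean`), the orbit
bundle `π : M → S` of a chronological stationary space-time is trivialised:

* `IsStationaryKilling.contMDiff_of_comp_orbitProj'` — the descent principle for maps into a
  manifold (as `StationaryOrbitDescent.lean`, any target);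
* `IsStationaryKilling.timeSection` — **the global section** `σ(z) = θ(-t(y), y)` (`y` any event
  over `z`; `timeSection_orbitProj` shows independence of `y`), with `π ∘ σ = id`
  (`orbitProj_timeSection`), `t ∘ σ = 0` (`apply_timeSection`), and `σ` is `C^∞`
  (`contMDiff_timeSection`);
* `IsStationaryKilling.trivialization` — **the diffeomorphism `M ≃ ℝ × S`, `y ↦ (t y, π y)`**,
  inverse `(s, z) ↦ θ(s, σ z)`, of class `C^∞` both ways (a Mathlib `Diffeomorph`), which
  conjugates the stationary flow to translation in the `ℝ`-factor
  (`trivialization_flow`: `Φ(θ(s, y)) = (t y + s, π y)`, i.e. `X = ∂_t`);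
* `Spacetime.IsStationaryKilling.exists_trivialization` — bundled: a chronological stationary
  spacetime (four-dimensional, complete Killing field timelike everywhere) is diffeomorphic to
  `ℝ × S` with the Killing flow acting by translations — the global form behind Anderson's (0.1)
  `g_M = -u²(dt + θ)² + π^* g_S`.

No named facts; the definitions depend on the chosen time function.

## References

* M. T. Anderson, Ann. Henri Poincaré 1 (2000) 977–994, arXiv:gr-qc/0001091, §0, (0.1) (key
  `Anderson2000`).
* R. Geroch, J. Math. Phys. 12 (1971) 918–924, App. A (key `Geroch1971`).
-/

noncomputable section

open Bundle Set Filter Function Manifold TopologicalSpace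
open scoped ContDiff Topology Manifold

namespace Literature.Geometry.Lorentzian

namespace LorentzianMetric

section Trivialization

variable {E : Type*} [NormedAddCommGroup E] [NormedSpace ℝ E] [FiniteDimensional ℝ E]
  [CompleteSpace E] {M : Type*} [TopologicalSpace M] [ChartedSpace E M]
  [IsManifold 𝓘(ℝ, E) ∞ M] [T2Space M]
  {g : LorentzianMetric 𝓘(ℝ, E) ∞ M} [g.HasLeviCivita] {τ : TimeOrientation g}
  {X : Π x : M, TangentSpace 𝓘(ℝ, E) x} {θ : ℝ × M → M}
  {F : Type*} [NormedAddCommGroup F] [NormedSpace ℝ F] [FiniteDimensional ℝ F]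
  {E' : Type*} [NormedAddCommGroup E'] [NormedSpace ℝ E'] {H' : Type*} [TopologicalSpace H']
  {I' : ModelWithCorners ℝ E' H'} {M' : Type*} [TopologicalSpace M'] [ChartedSpace H' M']

/-- **Descent of smooth maps to the orbit space, manifold-valued**: a map `f : S → M'` into any
manifold is `C^∞` as soon as `f ∘ π` is (slice charts: `f ∘ e⁻¹ = (f ∘ π) ∘ σ`). Lee 2012,
Thm. 4.29. [cite: LeeSmoothManifolds2013, Thm. 4.29] -/
theorem IsStationaryKilling.contMDiff_of_comp_orbitProj' (h : g.IsStationaryKilling τ X univ)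
    (hchr : g.IsChronological τ) (hθ : ContMDiff (𝓘(ℝ, ℝ).prod 𝓘(ℝ, E)) 𝓘(ℝ, E) ∞ θ)
    (hθ0 : ∀ p, θ (0, p) = p) (hθadd : ∀ t s p, θ (t, θ (s, p)) = θ (t + s, p))
    (hθX : ∀ p, IsMIntegralCurve (fun t ↦ θ (t, p)) X)
    (hF : Module.finrank ℝ F + 1 = Module.finrank ℝ E) {f : OrbitSpace X → M'}
    (hf : ContMDiff 𝓘(ℝ, E) I' ∞ (f ∘ orbitProj X)) :
    letI := h.orbitSpaceChartedSpace hchr (hθ.of_le (WithTop.coe_le_coe.mpr le_top)) hθ0 hθadd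
      hθX hF
    ContMDiff 𝓘(ℝ, F) I' ∞ f := by
  letI := h.orbitSpaceChartedSpace hchr (hθ.of_le (WithTop.coe_le_coe.mpr le_top)) hθ0 hθadd
    hθX hF
  haveI := h.isManifold_orbitSpace hchr hθ hθ0 hθadd hθX hF
  have hθ2 : ContMDiff (𝓘(ℝ, ℝ).prod 𝓘(ℝ, E)) 𝓘(ℝ, E) 2 θ :=
    hθ.of_le (WithTop.coe_le_coe.mpr le_top)
  intro z
  set p : M := z.out with hp
  set d : SliceData X θ F p := h.sliceDataAt hchr hθ2 hθ0 hθadd hθX hF p with hd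
  have hchart : chartAt F z = d.chart h.contMDiff_one hθX hθ0 := rfl
  have hzs : z ∈ (chartAt F z).source := mem_chart_source F z
  rw [contMDiffAt_iff_source_of_mem_source hzs]
  have hu₀ : chartAt F z z ∈ d.dom := by
    rw [← d.chart_target h.contMDiff_one hθX hθ0, hchart]
    exact (d.chart h.contMDiff_one hθX hθ0).map_source (hchart ▸ hzs)
  have hloc : ContMDiffOn 𝓘(ℝ, F) I' ∞ ((f ∘ orbitProj X) ∘ d.param) d.dom :=
    hf.comp_contMDiffOn d.contMDiffOn_param
  have hfun : f ∘ (extChartAt 𝓘(ℝ, F) z).symm = (f ∘ orbitProj X) ∘ d.param := by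
    funext u
    simp only [comp_apply, extChartAt, OpenPartialHomeomorph.extend_coe_symm,
      modelWithCornersSelf_coe_symm, CompTriple.comp_eq, hchart]
    rfl
  rw [hfun]
  have hpt : extChartAt 𝓘(ℝ, F) z z = chartAt F z z := by simp
  rw [hpt]
  exact (hloc.contMDiffAt (d.isOpen_dom.mem_nhds hu₀)).contMDiffWithinAt

/-! ### The global section of a time function -/

/-- **The global section** of the orbit bundle attached to a time function `t`
(`t(θ(s, y)) = t(y) + s`): `σ(z) = θ(-t(y), y)` for the representative `y = z.out`
(`timeSection_orbitProj`: any `y` over `z` gives the same point). Anderson 2000, §0, (0.1)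
(`M = ℝ × S`). [cite: Anderson2000, §0, (0.1)] -/
def IsStationaryKilling.timeSection (_h : g.IsStationaryKilling τ X univ) (θ : ℝ × M → M)
    (t : M → ℝ) (z : OrbitSpace X) : M :=
  θ (-t z.out, z.out)

variable {t : M → ℝ}

omit [FiniteDimensional ℝ E] [CompleteSpace E] in
/-- **The section does not depend on the representative**: `σ(π y) = θ(-t(y), y)`.
[folklore] -/
theorem IsStationaryKilling.timeSection_orbitProj (h : g.IsStationaryKilling τ X univ)
    (hθX : ∀ p, IsMIntegralCurve (fun t ↦ θ (t, p)) X) (hθ0 : ∀ p, θ (0, p) = p)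
    (hθadd : ∀ t s p, θ (t, θ (s, p)) = θ (t + s, p)) (htθ : ∀ s y, t (θ (s, y)) = t y + s)
    (y : M) : h.timeSection θ t (orbitProj X y) = θ (-t y, y) := by
  have hX1 := h.contMDiff_one
  have hc : IsCompleteVectorField X := fun x ↦ ⟨fun s ↦ θ (s, x), hθX x, hθ0 x⟩
  have hmem : (orbitProj X y).out ∈ stationaryOrbit X {y} := by
    rw [← orbitProj_eq_iff X hX1 hc]
    exact (Quotient.out_eq _).symm
  obtain ⟨s, hs⟩ := (mem_stationaryOrbit_singleton_iff_exists_flow_eq hX1 hθX hθ0).1 hmem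
  simp only [IsStationaryKilling.timeSection]
  rw [← hs, htθ, hθadd]
  congr 1
  ext <;> simp

omit [FiniteDimensional ℝ E] [CompleteSpace E] [T2Space M] in
/-- **`π ∘ σ = id`.** [folklore] -/
theorem IsStationaryKilling.orbitProj_timeSection (h : g.IsStationaryKilling τ X univ)
    (hθX : ∀ p, IsMIntegralCurve (fun t ↦ θ (t, p)) X) (hθ0 : ∀ p, θ (0, p) = p)
    (z : OrbitSpace X) : orbitProj X (h.timeSection θ t z) = z := by
  simp only [IsStationaryKilling.timeSection]
  rw [← orbitProj_eq_of_mem X ⟨fun s ↦ θ (s, z.out), hθX _, hθ0 _, _, rfl⟩]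
  exact Quotient.out_eq z

omit [FiniteDimensional ℝ E] [CompleteSpace E] [T2Space M] in
/-- **`t ∘ σ = 0`**: the section is the zero level of the time function. [folklore] -/
theorem IsStationaryKilling.apply_timeSection (h : g.IsStationaryKilling τ X univ)
    (htθ : ∀ s y, t (θ (s, y)) = t y + s) (z : OrbitSpace X) :
    t (h.timeSection θ t z) = 0 := by
  simp only [IsStationaryKilling.timeSection, htθ, add_neg_cancel]

/-- **The section is `C^∞`** (descent: `σ ∘ π = (y ↦ θ(-t y, y))` is `C^∞`).
[cite: Anderson2000, §0, (0.1)] -/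
theorem IsStationaryKilling.contMDiff_timeSection (h : g.IsStationaryKilling τ X univ)
    (hchr : g.IsChronological τ) (hθ : ContMDiff (𝓘(ℝ, ℝ).prod 𝓘(ℝ, E)) 𝓘(ℝ, E) ∞ θ)
    (hθ0 : ∀ p, θ (0, p) = p) (hθadd : ∀ t s p, θ (t, θ (s, p)) = θ (t + s, p))
    (hθX : ∀ p, IsMIntegralCurve (fun t ↦ θ (t, p)) X)
    (hF : Module.finrank ℝ F + 1 = Module.finrank ℝ E) (ht : ContMDiff 𝓘(ℝ, E) 𝓘(ℝ, ℝ) ∞ t)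
    (htθ : ∀ s y, t (θ (s, y)) = t y + s) :
    letI := h.orbitSpaceChartedSpace hchr (hθ.of_le (WithTop.coe_le_coe.mpr le_top)) hθ0 hθadd
      hθX hF
    ContMDiff 𝓘(ℝ, F) 𝓘(ℝ, E) ∞ (h.timeSection θ t) := by
  refine h.contMDiff_of_comp_orbitProj' hchr hθ hθ0 hθadd hθX hF ?_
  have hfun : h.timeSection θ t ∘ orbitProj X = fun y ↦ θ (-t y, y) :=
    funext fun y ↦ h.timeSection_orbitProj hθX hθ0 hθadd htθ y
  rw [hfun]
  exact hθ.comp (ht.neg.prodMk contMDiff_id)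

/-! ### The trivialisation `M ≃ ℝ × S` -/

/-- **The trivialisation of the orbit bundle by a time function**: the diffeomorphism
`Φ : M ≃ ℝ × S`, `y ↦ (t y, π y)`, with inverse `(s, z) ↦ θ(s, σ z)`, of class `C^∞` both ways.
Anderson 2000, §0, (0.1) (`M = ℝ × S`); Geroch 1971, App. A. [cite: Anderson2000, §0, (0.1)] -/
def IsStationaryKilling.trivialization (h : g.IsStationaryKilling τ X univ)
    (hchr : g.IsChronological τ) (hθ : ContMDiff (𝓘(ℝ, ℝ).prod 𝓘(ℝ, E)) 𝓘(ℝ, E) ∞ θ)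
    (hθ0 : ∀ p, θ (0, p) = p) (hθadd : ∀ t s p, θ (t, θ (s, p)) = θ (t + s, p))
    (hθX : ∀ p, IsMIntegralCurve (fun t ↦ θ (t, p)) X)
    (hF : Module.finrank ℝ F + 1 = Module.finrank ℝ E) (ht : ContMDiff 𝓘(ℝ, E) 𝓘(ℝ, ℝ) ∞ t)
    (htθ : ∀ s y, t (θ (s, y)) = t y + s) :
    letI := h.orbitSpaceChartedSpace hchr (hθ.of_le (WithTop.coe_le_coe.mpr le_top)) hθ0 hθadd
      hθX hF
    Diffeomorph 𝓘(ℝ, E) (𝓘(ℝ, ℝ).prod 𝓘(ℝ, F)) M (ℝ × OrbitSpace X) ∞ :=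
  letI := h.orbitSpaceChartedSpace hchr (hθ.of_le (WithTop.coe_le_coe.mpr le_top)) hθ0 hθadd
    hθX hF
  { toFun := fun y ↦ (t y, orbitProj X y)
    invFun := fun q ↦ θ (q.1, h.timeSection θ t q.2)
    left_inv := fun y ↦ by
      simp only
      rw [h.timeSection_orbitProj hθX hθ0 hθadd htθ y, hθadd, add_neg_cancel, hθ0]
    right_inv := fun q ↦ by
      ext
      · simp only [htθ, h.apply_timeSection htθ, zero_add]
      · simp only
        rw [← orbitProj_eq_of_mem X ⟨fun s ↦ θ (s, h.timeSection θ t q.2), hθX _, hθ0 _, q.1,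
          rfl⟩]
        exact h.orbitProj_timeSection hθX hθ0 q.2
    contMDiff_toFun := ht.prodMk (h.contMDiff_orbitProj hchr hθ hθ0 hθadd hθX hF)
    contMDiff_invFun :=
      hθ.comp (contMDiff_fst.prodMk
        ((h.contMDiff_timeSection hchr hθ hθ0 hθadd hθX hF ht htθ).comp contMDiff_snd)) }

/-- The trivialisation is `y ↦ (t y, π y)`. [folklore] -/
theorem IsStationaryKilling.trivialization_apply (h : g.IsStationaryKilling τ X univ)
    (hchr : g.IsChronological τ) (hθ : ContMDiff (𝓘(ℝ, ℝ).prod 𝓘(ℝ, E)) 𝓘(ℝ, E) ∞ θ)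
    (hθ0 : ∀ p, θ (0, p) = p) (hθadd : ∀ t s p, θ (t, θ (s, p)) = θ (t + s, p))
    (hθX : ∀ p, IsMIntegralCurve (fun t ↦ θ (t, p)) X)
    (hF : Module.finrank ℝ F + 1 = Module.finrank ℝ E) (ht : ContMDiff 𝓘(ℝ, E) 𝓘(ℝ, ℝ) ∞ t)
    (htθ : ∀ s y, t (θ (s, y)) = t y + s) (y : M) :
    letI := h.orbitSpaceChartedSpace hchr (hθ.of_le (WithTop.coe_le_coe.mpr le_top)) hθ0 hθadd
      hθX hF
    h.trivialization hchr hθ hθ0 hθadd hθX hF ht htθ y = (t y, orbitProj X y) := rfl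

/-- The inverse trivialisation is `(s, z) ↦ θ(s, σ z)`. [folklore] -/
theorem IsStationaryKilling.trivialization_symm_apply (h : g.IsStationaryKilling τ X univ)
    (hchr : g.IsChronological τ) (hθ : ContMDiff (𝓘(ℝ, ℝ).prod 𝓘(ℝ, E)) 𝓘(ℝ, E) ∞ θ)
    (hθ0 : ∀ p, θ (0, p) = p) (hθadd : ∀ t s p, θ (t, θ (s, p)) = θ (t + s, p))
    (hθX : ∀ p, IsMIntegralCurve (fun t ↦ θ (t, p)) X)
    (hF : Module.finrank ℝ F + 1 = Module.finrank ℝ E) (ht : ContMDiff 𝓘(ℝ, E) 𝓘(ℝ, ℝ) ∞ t)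
    (htθ : ∀ s y, t (θ (s, y)) = t y + s) (q : ℝ × OrbitSpace X) :
    letI := h.orbitSpaceChartedSpace hchr (hθ.of_le (WithTop.coe_le_coe.mpr le_top)) hθ0 hθadd
      hθX hF
    (h.trivialization hchr hθ hθ0 hθadd hθX hF ht htθ).symm q =
      θ (q.1, h.timeSection θ t q.2) := rfl

/-- **The trivialisation conjugates the stationary flow to time translation**:
`Φ(θ(s, y)) = (t y + s, π y)` — in `M ≅ ℝ × S` the Killing field is `∂_t` (Anderson 2000, §0,
(0.1)). [cite: Anderson2000, §0, (0.1)] -/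
theorem IsStationaryKilling.trivialization_flow (h : g.IsStationaryKilling τ X univ)
    (hchr : g.IsChronological τ) (hθ : ContMDiff (𝓘(ℝ, ℝ).prod 𝓘(ℝ, E)) 𝓘(ℝ, E) ∞ θ)
    (hθ0 : ∀ p, θ (0, p) = p) (hθadd : ∀ t s p, θ (t, θ (s, p)) = θ (t + s, p))
    (hθX : ∀ p, IsMIntegralCurve (fun t ↦ θ (t, p)) X)
    (hF : Module.finrank ℝ F + 1 = Module.finrank ℝ E) (ht : ContMDiff 𝓘(ℝ, E) 𝓘(ℝ, ℝ) ∞ t)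
    (htθ : ∀ s y, t (θ (s, y)) = t y + s) (s : ℝ) (y : M) :
    letI := h.orbitSpaceChartedSpace hchr (hθ.of_le (WithTop.coe_le_coe.mpr le_top)) hθ0 hθadd
      hθX hF
    h.trivialization hchr hθ hθ0 hθadd hθX hF ht htθ (θ (s, y)) = (t y + s, orbitProj X y) := by
  letI := h.orbitSpaceChartedSpace hchr (hθ.of_le (WithTop.coe_le_coe.mpr le_top)) hθ0 hθadd
    hθX hF
  rw [h.trivialization_apply, htθ,
    ← orbitProj_eq_of_mem X ⟨fun s ↦ θ (s, y), hθX y, hθ0 y, s, rfl⟩]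

end Trivialization

end LorentzianMetric

/-! ### The bundled form -/

namespace Spacetime

universe u

variable {𝓢 : Spacetime.{u} 4} [𝓢.metric.HasLeviCivita]
  {X : Π x : 𝓢.carrier, TangentSpace (𝓡 4) x}

/-- **Anderson 2000, §0, (0.1), for a bundled spacetime: `M ≅ ℝ × S` with `X = ∂_t`.** A
chronological stationary spacetime (four-dimensional, complete Killing field timelike
everywhere) admits a `C^∞` time function `t` and a diffeomorphism `Φ : M ≃ ℝ × S` with
`Φ y = (t y, π y)` conjugating the stationary flow to translation of the first factor:
`Φ(θ(s, y)) = (t y + s, π y)`. [cite: Anderson2000, §0, (0.1)] -/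
theorem IsStationaryKilling.exists_trivialization (hX : 𝓢.IsStationaryKilling X univ)
    (hchr : 𝓢.metric.IsChronological 𝓢.timeOrientation) :
    letI := hX.orbitSpaceChartedSpace hchr
    ∃ (t : 𝓢.carrier → ℝ)
      (Φ : Diffeomorph (𝓡 4) (𝓘(ℝ, ℝ).prod (𝓡 3)) 𝓢.carrier (ℝ × OrbitSpace X) ∞),
      ContMDiff (𝓡 4) 𝓘(ℝ, ℝ) ∞ t ∧ (∀ y, Φ y = (t y, orbitProj X y)) ∧
        ∀ (s : ℝ) (y : 𝓢.carrier), Φ (hX.flow (s, y)) = (t y + s, orbitProj X y) := by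
  letI := hX.orbitSpaceChartedSpace hchr
  obtain ⟨t, ht, htθ⟩ := hX.exists_timeFunction hchr
  have hF : Module.finrank ℝ (EuclideanSpace ℝ (Fin 3)) + 1 =
      Module.finrank ℝ (EuclideanSpace ℝ (Fin 4)) := by simp [finrank_euclideanSpace]
  refine ⟨t, LorentzianMetric.IsStationaryKilling.trivialization hX hchr hX.contMDiff_flow
    hX.flow_zero hX.flow_add hX.isMIntegralCurve_flow hF ht htθ, ht, fun y ↦ rfl, fun s y ↦ ?_⟩
  exact LorentzianMetric.IsStationaryKilling.trivialization_flow hX hchr hX.contMDiff_flow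
    hX.flow_zero hX.flow_add hX.isMIntegralCurve_flow hF ht htθ s y

end Spacetime

end Literature.Geometry.Lorentzian

end
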